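import Literature.AlgebraicGeometry.GroupSchemes.RelativeFrobeniusBaseChange
import Literature.AlgebraicGeometry.Motives.AbelianVarietyFrobeniusTwistVariety
import HarnessLib

/-!
# The fibre of the Frobenius twist, of `F_{X/S}` and of `Ker F_{G/S}` over a field-valued point: identification with
# `frobeniusTwistOver` ∕ `relFrobeniusOver` (SGA 3 VII_A 4.1; Milne, *Étale cohomology* VI Rem. 13.5)

Topic `AlgebraicGeometry/GroupSchemes`; namespace `Literature.AlgebraicGeometry.GroupSchemes.RelFrobenius` (continues ★
`RelativeFrobeniusBaseChange`).  DEFINITIONS WITH BODIES (isomorphisms, instances of ★ `pullbackSquareIso` ∕ ★ `kerCompIso`)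
and fully proved theorems: **no named fact, no `sorry`, no instance, no notation**.  Cell `pub/hodgecm-mathlib`, programme
P6 («MOD»), piece (d1), second half: the form in which the pointwise (`κ̄`-points) arguments of the door P″ read the
`S`-level organ (O3a∕O3b) through B-p12's ★ `Motives/AbelianVarietyFrobeniusTwistVariety` (`frobSpec`, `absFrobeniusOver`,
`frobeniusTwistOver`, `relFrobeniusOver`; `AbelianVariety.frobeniusTwist p r A` has underlying scheme `frobeniusTwistOver p r A.X`
and `(A.relFrobenius p r).hom.hom.hom = relFrobeniusOver p r A.X`, both by `rfl` there).

## Mathematics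

`k = 𝔽_q` finite, `q = p^r`, `S` a `k`-scheme, `L` a field of characteristic `p`.  The `q`-Frobenius of `Spec L` over `k`
(`L ⊇ k`) is `Spec` of `x ↦ x^q = Frob_p^r` (★ `powEndo_Spec_eq_frobSpec`), so the `q`-Frobenius `F_S` MOVES an `L`-valued
point `x` of `S` over `k` to `F_S ∘ x = x ∘ Spec Frob^r` (naturality ★ `frobeniusOver_comp`).  For any `x₀ : Spec L → S` with
this square, base change along it (★ `pullbackSquareIso`) gives `(X^{(q/S)})_{x₀} ≅ (X_{x₀}) ×_{L,Frob^r} L = (X_{x₀})^{(q)}`,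
under which `(F_{X/S})_{x₀} = F_{X_{x₀}/L}` (the two projections: «absolute `p^r`-Frobenius, then project» and the structure
map), compatibly with transported group laws, whence `(Ker F_{G/S})_{x₀} ≅ Ker F_{G_{x₀}/L}` [SGA3I, VII_A 4.1; Milne2025, VI
Rem. 13.5 «`F_{X̄/k} = (1 ⊗ f) ∘ F`»].

## Contents (`k` finite; `S : SchemeOver k`; `p r : ℕ`; `L` a field, `[ExpChar L p]`; `hq : Nat.card k = p ^ r`)
* `powEndo_exponent_congr`, `absFrob_eq_powEndo_pow`, `frobeniusOver_left_eq_absFrobeniusOver` (the finite-field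
  `frobeniusOver` is B-p12's `absFrobeniusOver p r` on schemes), **`frobeniusOver_specOver_left : F_{Spec L/k} = frobSpec L p r`**,
  `point_left_comp_frobeniusOver_left`, **`comp_frobeniusOver_left : (x ≫ F_S).left = frobSpec L p r ≫ x.left`** (moved point).
* For `x₀ : Spec L ⟶ S.left` with `hx : x₀ ≫ F_S = frobSpec L p r ≫ x₀`: **`frobTwistFibreIso`**, **`frobTwistFibreObjIso :
  (X^{(q/S)})_{x₀} ≅ frobeniusTwistOver p r (X_{x₀})`** (+ `_hom_left_twistFst_fst∕_snd`), **`pullback_map_relFrobenius_comp_fibre`**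
  (`(F_{X/S})_{x₀} ≫ ≅ = relFrobeniusOver p r (X_{x₀})`), `frobTwistFibreGrpIso` (+ `_hom_hom_hom`), `isMonHom_frobTwistFibreObjIso_hom`,
  **`frobKernelFibreIso : (Ker F_{G/S})_{x₀} ≅ Ker (relFrobeniusOver p r (G_{x₀}))`** (+ `_hom_comp_kerι`).

NOT here: the abelian-scheme reading (`AbelianSchemeOver.fibre`, `AbelianVariety.frobeniusTwist`, sections ∕ level structures at
the moved point).  HC_CM is proved only modulo the printed citations until rung 0 closes; this file changes no count.

## References
* [SGA3I] M. Demazure, A. Grothendieck (eds.), *SGA 3, Tome I*, Exp. VII_A (P. Gabriel), 4.1.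
* [Milne2025] J. S. Milne, *Étale cohomology*, VI §13 Rem. 13.5 (`F_{X/k}`, `X^{(q)}`, `F_{X̄/k} = (1 ⊗ f) ∘ F`).
* [GortzWedhorn2020] U. Görtz, T. Wedhorn, *Algebraic Geometry I* (2nd ed.), Section (4.7), Prop. 4.16, Def. 4.24, Def. 4.45.
* [Hartshorne1977] R. Hartshorne, *Algebraic Geometry*, IV §2 Rem. 2.4.1.
-/

set_option autoImplicit false

noncomputable section

-- Compositions through `((Over.pullback f).obj X).left = pullback X.hom f` and `(specOver k L).left = Spec L` are
-- definitional only above `instances` transparency (as in ★ `RelativeFrobeniusBaseChange` and ★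
-- `Motives/AbelianVarietyFrobeniusTwistVariety`).
set_option backward.isDefEq.respectTransparency false

universe u

open CategoryTheory CategoryTheory.Limits AlgebraicGeometry MonoidalCategory

namespace Literature.AlgebraicGeometry.GroupSchemes.RelFrobenius

open Literature.AlgebraicGeometry.Motives Literature.AlgebraicGeometry.Limits GroupSchemeKernel
open scoped MonObj Obj

variable {k : Type u} [Field k] [Finite k]

/-! ## §1 The `q`-Frobenius with exponent `p^r`; `Spec L`; the moved point -/

section Exponent

/-- `powEndo` only depends on the exponent (proof-irrelevance bookkeeping for `Nat.card k = p ^ r`). [folklore] -/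
private theorem powEndo_exponent_congr {X : Scheme.{u}} {m n : ℕ} (hmn : m = n) (hm : m ≠ 0)
    (haddm : ∀ (U : X.Opens) (a b : Γ(X, U)), (a + b) ^ m = a ^ m + b ^ m) (hn : n ≠ 0)
    (haddn : ∀ (U : X.Opens) (a b : Γ(X, U)), (a + b) ^ n = a ^ n + b ^ n) :
    powEndo X m hm haddm = powEndo X n hn haddn := by
  subst hmn
  rfl

variable (S : SchemeOver k) (p r : ℕ)

/-- For `q = #k = p^r` the absolute `q`-Frobenius `F_X` of an `S`-scheme (★ `absFrob`) is the `p^r`-power endomorphism. [cite: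
GortzWedhorn2020, Def. 4.24] -/
theorem absFrob_eq_powEndo_pow (hq : Nat.card k = p ^ r) (X : Over S.left) :
    absFrob S X = powEndo X.left (p ^ r) (hq ▸ card_ne_zero)
      (fun U a b ↦ hq ▸ add_pow_card_sections (overField S X) U a b) :=
  powEndo_exponent_congr hq _ _ _ _

/-- For `q = #k = p^r`, the `q`-Frobenius `F_{X/k}` of a `k`-scheme (★ `frobeniusOver`, finite base field) is, on the
underlying scheme, the absolute `p^r`-Frobenius ★ `absFrobeniusOver p r` of B-p12's file. [cite: Hartshorne1977, IV §2 Rem.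
2.4.1] -/
theorem frobeniusOver_left_eq_absFrobeniusOver [ExpChar k p] (hq : Nat.card k = p ^ r) (X : SchemeOver k) :
    (frobeniusOver X).left = absFrobeniusOver p r X := by
  rw [frobeniusOver_left]
  exact powEndo_exponent_congr hq _ _ _ _

variable {L : Type u} [Field L] [Algebra k L] [ExpChar L p]

/-- **On `Spec L`, `L ⊇ k = 𝔽_q` a field, the `q`-Frobenius over `k` is `Spec` of `x ↦ x^q = Frob_p^r`** (the tree's `frobSpec
L p r`; Milne VI Rem. 13.5 «`F_{X̄/k} = (1 ⊗ f) ∘ F`» for `X = Spec k`). [cite: Milne2025, VI §13 Rem. 13.5] -/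
theorem frobeniusOver_specOver_left (hq : Nat.card k = p ^ r) :
    (frobeniusOver (specOver k L)).left = frobSpec L p r := by
  rw [frobeniusOver_left, ← AbelianVariety.absFrobeniusOver_specOver (k := L) p r]
  exact powEndo_exponent_congr hq _ _ _ _

/-- The square of the `L`-valued point `x` of `S` over `k`: `F_S ∘ x = x ∘ Spec Frob^r` on schemes (naturality ★
`frobeniusOver_comp` and `frobeniusOver_specOver_left`) — the hypothesis `hx` of the fibre isomorphisms below. [cite:
Milne2025, VI §13 Rem. 13.5] -/
theorem point_left_comp_frobeniusOver_left (hq : Nat.card k = p ^ r) (x : specOver k L ⟶ S) :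
    x.left ≫ (frobeniusOver S).left = frobSpec L p r ≫ x.left := by
  rw [left_comp_frobeniusOver_left x, frobeniusOver_specOver_left p r hq]

/-- **The Frobenius-moved point**: `(x ≫ F_S) = Spec Frob^r ≫ x` on schemes, i.e. the `q`-Frobenius of `S` moves an `L`-valued
point to its Frobenius conjugate. [cite: Milne2025, VI §13 Rem. 13.5] -/
theorem comp_frobeniusOver_left (hq : Nat.card k = p ^ r) (x : specOver k L ⟶ S) :
    (x ≫ frobeniusOver S).left = frobSpec L p r ≫ x.left := by
  rw [Over.comp_left, point_left_comp_frobeniusOver_left S p r hq x]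

end Exponent

/-! ## §2 The fibre over `x₀ : Spec L → S` with `x₀ ≫ F_S = Spec Frob^r ≫ x₀` -/

section Fibre

variable (S : SchemeOver k) {L : Type u} [Field L] (p r : ℕ) [ExpChar L p]
  (x₀ : Spec (.of L) ⟶ S.left) (hx : x₀ ≫ (frobeniusOver S).left = frobSpec L p r ≫ x₀)

/-- **The fibre of the twist over a field-valued point is the Frobenius twist of the fibre**: for `x₀ : Spec L → S` with `F_S
∘ x₀ = x₀ ∘ Spec Frob^r` (e.g. an `L`-point over `k`, `point_left_comp_frobeniusOver_left`), `Over.pullback F_S ⋙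
Over.pullback x₀ ≅ Over.pullback x₀ ⋙ Over.pullback (Spec Frob^r)` — the right-hand side being B-p12's `frobeniusTwistOver p
r` of the fibre. [cite: SGA3I, VII_A 4.1] [cite: Milne2025, VI §13 Rem. 13.5] -/
def frobTwistFibreIso :
    Over.pullback (frobeniusOver S).left ⋙ Over.pullback x₀ ≅ Over.pullback x₀ ⋙ Over.pullback (frobSpec L p r) :=
  pullbackSquareIso (frobeniusOver S).left x₀ (frobSpec L p r) x₀ hx

variable (X : Over S.left)

/-- The component at `X`: `(X^{(q/S)})_{x₀} ≅ (X_{x₀})^{(q)} = frobeniusTwistOver p r (X_{x₀})` over `L`. [cite: SGA3I, VII_A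
4.1] [cite: Milne2025, VI §13 Rem. 13.5] -/
def frobTwistFibreObjIso :
    (Over.pullback x₀).obj (frobTwist S X) ≅ frobeniusTwistOver p r ((Over.pullback x₀).obj X) :=
  (frobTwistFibreIso S p r x₀ hx).app X

/-- Projection to `X`: first coordinates agree. [cite: GortzWedhorn2020, Section (4.7), Prop. 4.16] -/
@[reassoc]
theorem frobTwistFibreObjIso_hom_left_twistFst_fst :
    (frobTwistFibreObjIso S p r x₀ hx X).hom.left ≫ Motives.twistFst p r ((Over.pullback x₀).obj X) ≫
        pullback.fst X.hom x₀ =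
      pullback.fst (frobTwist S X).hom x₀ ≫ twistFst S X :=
  pullbackSquareIso_hom_app_left_fst_fst _ _ _ _ _ X

/-- Projection to `Spec L` through `X_{x₀}`: it is `Spec Frob^r` of the `L`-coordinate. [cite: GortzWedhorn2020, Section
(4.7), Prop. 4.16] -/
@[reassoc]
theorem frobTwistFibreObjIso_hom_left_twistFst_snd :
    (frobTwistFibreObjIso S p r x₀ hx X).hom.left ≫ Motives.twistFst p r ((Over.pullback x₀).obj X) ≫
        pullback.snd X.hom x₀ =
      pullback.snd (frobTwist S X).hom x₀ ≫ frobSpec L p r :=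
  pullbackSquareIso_hom_app_left_fst_snd _ _ _ _ _ X

/-- **The fibre of `F_{X/S}` over `x₀` is the relative Frobenius `F_{X_{x₀}/L}` of B-p12's file** (`relFrobeniusOver p r`),
under `frobTwistFibreObjIso` (`q = #k = p^r`). [cite: SGA3I, VII_A 4.1] [cite: Milne2025, VI §13 Rem. 13.5] -/
theorem pullback_map_relFrobenius_comp_fibre (hq : Nat.card k = p ^ r) :
    (Over.pullback x₀).map (relFrobenius S X) ≫ (frobTwistFibreObjIso S p r x₀ hx X).hom =
      relFrobeniusOver p r ((Over.pullback x₀).obj X) := by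
  have h1 : ((Over.pullback x₀).map (relFrobenius S X)).left ≫ pullback.fst (frobTwist S X).hom x₀ =
      pullback.fst X.hom x₀ ≫ (relFrobenius S X).left := by
    simp only [Over.pullback_map_left, pullback.lift_fst]
  have h2 : ((Over.pullback x₀).map (relFrobenius S X)).left ≫ pullback.snd (frobTwist S X).hom x₀ =
      pullback.snd X.hom x₀ := by
    simp only [Over.pullback_map_left, pullback.lift_snd]
  have hsq : Motives.twistFst p r ((Over.pullback x₀).obj X) ≫ pullback.snd X.hom x₀ =
      Motives.twistSnd p r ((Over.pullback x₀).obj X) ≫ frobSpec L p r :=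
    Motives.twistFst_comp_hom p r ((Over.pullback x₀).obj X)
  apply frobeniusTwistOver_hom_ext p r
  apply pullback.hom_ext
  · simp only [Over.comp_left, Category.assoc]
    rw [frobTwistFibreObjIso_hom_left_twistFst_fst, ← Category.assoc, h1, Category.assoc, relFrobenius_left_comp_twistFst,
      relFrobeniusOver_left_comp_fst_assoc, absFrob_eq_powEndo_pow S p r hq]
    exact (powEndo_comp _ _ _ _ _).symm
  · simp only [Over.comp_left, Category.assoc]
    rw [frobTwistFibreObjIso_hom_left_twistFst_snd, ← Category.assoc, h2, hsq, relFrobeniusOver_left_comp_snd_assoc]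
    rfl

variable (G : Over S.left) [GrpObj G]

/-- **The fibre of the twist AS GROUP SCHEMES**: `(G^{(q/S)})_{x₀} ≅ (G_{x₀})^{(q)}` in `Grp (Over (Spec L))` for the
transported group laws (B-p12's group structure on `frobeniusTwistOver` is the same `Functor.grpObjObj`). [cite: SGA3I, VII_A
4.1] -/
def frobTwistFibreGrpIso :
    (Over.pullback x₀).mapGrp.obj ((Over.pullback (frobeniusOver S).left).mapGrp.obj (Grp.mk G)) ≅
      (Over.pullback (frobSpec L p r)).mapGrp.obj ((Over.pullback x₀).mapGrp.obj (Grp.mk G)) :=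
  (Functor.mapGrpCompIso.symm ≪≫ Functor.mapGrpNatIso (frobTwistFibreIso S p r x₀ hx) ≪≫ Functor.mapGrpCompIso).app
    (Grp.mk G)

/-- Its underlying `L`-morphism is `frobTwistFibreObjIso`. [cite: SGA3I, VII_A 4.1] -/
theorem frobTwistFibreGrpIso_hom_hom_hom :
    (frobTwistFibreGrpIso S p r x₀ hx G).hom.hom.hom = (frobTwistFibreObjIso S p r x₀ hx G).hom := by
  simp [-frobeniusOver_left, frobTwistFibreGrpIso, frobTwistFibreObjIso, Functor.mapGrpNatIso, Functor.mapGrpCompIso]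
  exact Category.id_comp _

/-- `frobTwistFibreObjIso` at an `S`-group is a homomorphism for the transported group laws. [cite: SGA3I, VII_A 4.1] -/
theorem isMonHom_frobTwistFibreObjIso_hom : IsMonHom (frobTwistFibreObjIso S p r x₀ hx G).hom := by
  have h : IsMonHom (frobTwistFibreGrpIso S p r x₀ hx G).hom.hom.hom := inferInstance
  rw [frobTwistFibreGrpIso_hom_hom_hom] at h
  exact h

/-- **The fibre of `Ker F_{G/S}` over `x₀` is the kernel of the relative Frobenius `F_{G_{x₀}/L}`**: `(Ker F_{G/S})_{x₀} ≅ Ker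
(relFrobeniusOver p r (G_{x₀}))` over `L` (`q = #k = p^r`). [cite: SGA3I, VII_A 4.1] [cite: GortzWedhorn2020, (4.15) and
Definition 4.45 (2)] -/
def frobKernelFibreIso (hq : Nat.card k = p ^ r) :
    (Over.pullback x₀).obj (frobKernel S G) ≅ ker (relFrobeniusOver p r ((Over.pullback x₀).obj G)) :=
  haveI := isMonHom_frobTwistFibreObjIso_hom S p r x₀ hx G
  GroupSchemeKernel.baseChangeIso x₀ (relFrobenius S G) ≪≫
    kerCompIso ((Over.pullback x₀).map (relFrobenius S G)) (frobTwistFibreObjIso S p r x₀ hx G)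
      (relFrobeniusOver p r ((Over.pullback x₀).obj G)) (pullback_map_relFrobenius_comp_fibre S p r x₀ hx G hq)

/-- `frobKernelFibreIso` commutes with the inclusions into `G_{x₀}`. [cite: GortzWedhorn2020, (4.15) and Definition 4.45 (2)] -/
@[reassoc]
theorem frobKernelFibreIso_hom_comp_kerι (hq : Nat.card k = p ^ r) :
    (frobKernelFibreIso S p r x₀ hx G hq).hom ≫ kerι (relFrobeniusOver p r ((Over.pullback x₀).obj G)) =
      (Over.pullback x₀).map (frobKernelι S G) := by
  rw [frobKernelFibreIso, Iso.trans_hom, Category.assoc, kerCompIso_hom_comp_kerι]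
  exact GroupSchemeKernel.baseChangeIso_hom_comp_kerι x₀ (relFrobenius S G)

end Fibre

end Literature.AlgebraicGeometry.GroupSchemes.RelFrobenius
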